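import Summits.NavierStokesRegularity.FluidComputer.GateBudgetSwingClock
import HarnessLib

/-!
# GateBudget part 101 — the swing transfer, I: the entry half band (§278–§279)

Cell `pub-fluidc`, blueprint seat bp1 (gen 38, fifth item); namespace
`Summit.NavierStokesRegularity.FluidComputer.GateBudget`, knob family
`RotorKnob.rotorCircuit K M ε ρ` (modes `0 = a` carrier, `1 = b` clock, `2 = c` trigger,
`3 = d` transfer, `4 = ã` output) from `delayInit`, trigger primitive `C` (`C' = c`). Imports
part 99 (`GateBudgetSwingClock`: the angle laws and the swing primitive). HONEST FRAMING: a
low prior, high value-of-information experiment on Tao's machine paradigm; NOT a claim that NS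
blows up. Nothing here is about the Navier–Stokes equations.

THE POINT (SPEC-INPUT-bp1 §BV/§BW, the swing law; third file). The output of a pulse is
`ã' = Kd²`; on the swing band the clock angle `α = arccos(b/R₂)` advances at rate `≥ λc`,
`λ = ε⁻¹Mκ` (part 99 §274), the trigger is `≥ R₂ sin α` (§275), and on the unit lattice
`ε⁻¹Mρ² = 1` the dose phase IS the pump action: `(C(s) - C(r))/ρ² = ε⁻¹M(C(s) - C(r))`. So if
the transfer mode is phase-locked, `d² ≤ A(sin²(Φ + φ₀) + E)` (part 14 §43's tracking law in
the form part 102 will supply), then along the ENTRY HALF of the band — from the edge `t₁`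
(`α = α₁`) to the dose midpoint `C = (C(t₁) + C(t₂))/2` — the comparison angle
`w = α₁ + λ(C - C(t₁))` satisfies `w ≤ α ≤ π - w` (the lower law run forward from `t₁` and
backward from the symmetric exit edge `t₂`, `b(t₂) = -b(t₁)`), hence `sin α ≥ sin w`,
`w ≤ π/2`, and
`Kd² ≤ (KA/(λR₂))·((sin²(w + ψ₁) + E₁)/sin w)·(λc) = (KA/(λR₂))·(d/ds) swingPrim ψ₁ E₁ (w)`
with the ENTRY OFFSET `ψ₁ = Φ₁ + φ₀ - α₁` and `E₁ = E + π(κ⁻¹ - 1)` (the lag of `w` behind the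
phase, `(κ⁻¹ - 1)(w - α₁) ≤ (κ⁻¹ - 1)π/2`, costs `sin²(x + l) ≤ sin²x + 2|l|`). The output
over the entry half is at most `(KA/(λR₂))·(swingPrim(w) - swingPrim(α₁))`, and part 99 §275
`swingPrim_eval_le` prices that: `≤ (KA/(λR₂))·(cos²ψ₁ cos α₁ + |sin 2ψ₁|(1 - sin α₁)
- (sin²ψ₁ + E₁) log tan(α₁/2))` — `0.981·KA/(λR₂)` for `cos α₁ = 31/32`, `|ψ₁| ≤ 0.0075`,
against the crude `K·(duration)`. The exit half is the mirror image (part 102).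

* §278 `sin_sq_shift_le`, `sin_le_sin_of_window`, `swing_step_le`, `swingAngle`,
  `hasDerivAt_swingAngle`: the scalar devices (phase lag; `0 ≤ w ≤ α ≤ π - w ⇒ sin w ≤ sin α`;
  the pointwise transfer step; the comparison angle and its derivative `λc`).
* §279 `swing_window` (any member, `ε, M > 0`, hypotheses of part 99 `clock_angle_lower` on
  `[t₁, t₂]` and `b(t₂) = -b(t₁)`): `α₁ + λ(C(s) - C(t₁)) ≤ α(s) ≤ π - α₁ - λ(C(t₂) - C(s))`,
  `0 < α₁`; `swing_transfer_first`, THE ENTRY HALF-BAND LAW (any member, `K ≥ 0`, unit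
  lattice, `0 < κ ≤ 1`, `A, E ≥ 0`, `c ≥ 0` on the band, phase-locked transfer mode): for
  `t ∈ [t₁, t₂]` with `2C(t) ≤ C(t₁) + C(t₂)`:
  `ã(t) - ã(t₁) ≤ (KA/(λR₂))·(swingPrim ψ₁ E₁ (α₁ + λ(C(t) - C(t₁))) - swingPrim ψ₁ E₁ α₁)`
  (with `0 < α₁ ≤ w(t) ≤ π/2`); `swing_transfer_first_le`: the priced form above.

HONEST LIMITS. (i) Generic in the member: the phase-locking hypothesis
`d² ≤ A(sin²((C - C(r))/ρ² + φ₀) + E)` on `[t₁, t₂]` is ASSUMED here and discharged from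
part 14 §43 only in part 102 (with `A = a(r)² + d(r)²`, `E = O(L(T' - r))`); (ii) `k = 1`
only (`ε⁻¹Mρ² = 1`): for `k ≥ 2` the phase runs `k` times faster than the clock angle and the
primitive is another function — not treated (the `k²/3` climb term dominates there anyway);
(iii) the exit half, the sum over the band and the pulse ceiling `U₁` are parts 102–103;
until then `U = 7/2 + k²/3` stands and `≈ 1.96A/(θK⁹)` per swing is a FORECAST; (iv) nothing
about Navier–Stokes.
[cite: Tao2016AveragedNS, §5.5 Theorem 5.3, (5.5), (b-eq), (c-eq), (ta-eq), (energy-con)]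
-/

noncomputable section

namespace Summit.NavierStokesRegularity.FluidComputer.GateBudget

open Real Set Filter Topology
open Literature.Analysis.FluidPDE.Tao2016AveragedNS

variable {K M ε ρ : ℝ} {X : ℝ → Fin 5 → ℝ} {C : ℝ → ℝ}

/-! ## §278 Scalar devices -/

/-- §278(a) a phase lag costs at most twice its size: `sin(x + l)² ≤ sin x² + 2|l|`
(`|sin(x + l) - sin x| ≤ |l|`, `|sin(x + l) + sin x| ≤ 2`). [derived: Mathlib] -/
theorem sin_sq_shift_le (x l : ℝ) : sin (x + l) ^ 2 ≤ sin x ^ 2 + 2 * |l| := by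
  have h1 : |sin (x + l) - sin x| ≤ |l| := by
    simpa [add_sub_cancel_left] using Real.abs_sin_sub_sin_le (x + l) x
  have h2 : |sin (x + l) + sin x| ≤ 2 := by
    calc |sin (x + l) + sin x| ≤ |sin (x + l)| + |sin x| := abs_add_le _ _
      _ ≤ 1 + 1 := add_le_add (abs_sin_le_one _) (abs_sin_le_one _)
      _ = 2 := by norm_num
  have h3 : sin (x + l) ^ 2 - sin x ^ 2 = (sin (x + l) - sin x) * (sin (x + l) + sin x) := by
    ring
  have h4 : |sin (x + l) ^ 2 - sin x ^ 2| ≤ |l| * 2 := by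
    rw [h3, abs_mul]
    exact mul_le_mul h1 h2 (abs_nonneg _) (abs_nonneg _)
  have h5 := le_abs_self (sin (x + l) ^ 2 - sin x ^ 2)
  linarith only [h4, h5]

/-- §278(b) THE WINDOW DEVICE: `0 ≤ w ≤ α ≤ π - w` forces `sin w ≤ sin α` (if `α ≤ π/2` by
monotonicity, else through `sin α = sin(π - α)`). [derived: Mathlib] -/
theorem sin_le_sin_of_window {w α : ℝ} (hw : 0 ≤ w) (h1 : w ≤ α) (h2 : α ≤ π - w) :
    sin w ≤ sin α := by
  rcases le_or_gt α (π / 2) with h | h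
  · exact sin_le_sin_of_le_of_le_pi_div_two (by linarith only [hw, pi_pos]) h h1
  · rw [← sin_pi_sub α]
    exact sin_le_sin_of_le_of_le_pi_div_two (by linarith only [hw, pi_pos])
      (by linarith only [h]) (by linarith only [h2])

/-- §278(c) THE POINTWISE TRANSFER STEP (pure algebra; `K, A ≥ 0`, `λ, R₂ > 0`, `sin w > 0`,
`E₁ ≥ 0`): `d² ≤ A(sin²(w + ψ) + E₁)` and `R₂ sin w ≤ c` give
`K·d² ≤ (KA/(λR₂))·((sin²(w + ψ) + E₁)/sin w)·(λc)`. [derived: this file] -/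
theorem swing_step_le {K A lam R₂ w ψ E₁ dsq c : ℝ} (hK : 0 ≤ K) (hA : 0 ≤ A)
    (hlam : 0 < lam) (hR : 0 < R₂) (hw : 0 < sin w) (hE : 0 ≤ E₁)
    (hd : dsq ≤ A * (sin (w + ψ) ^ 2 + E₁)) (hc : R₂ * sin w ≤ c) :
    K * dsq ≤ K * A / (lam * R₂) * ((sin (w + ψ) ^ 2 + E₁) / sin w * (lam * c)) := by
  have hG : 0 ≤ K * A * (sin (w + ψ) ^ 2 + E₁) := by positivity
  have e : K * A / (lam * R₂) * ((sin (w + ψ) ^ 2 + E₁) / sin w * (lam * c))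
      = K * A * (sin (w + ψ) ^ 2 + E₁) * (c / (R₂ * sin w)) := by
    field_simp
  rw [e]
  have h1 : 1 ≤ c / (R₂ * sin w) := by
    rw [le_div_iff₀ (by positivity), one_mul]
    exact hc
  have h2 : K * dsq ≤ K * A * (sin (w + ψ) ^ 2 + E₁) := by
    have := mul_le_mul_of_nonneg_left hd hK
    linarith only [this]
  calc K * dsq ≤ K * A * (sin (w + ψ) ^ 2 + E₁) * 1 := by linarith only [h2]
    _ ≤ K * A * (sin (w + ψ) ^ 2 + E₁) * (c / (R₂ * sin w)) := mul_le_mul_of_nonneg_left h1 hG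

/-- §278(d) THE COMPARISON ANGLE run from the entry edge `t₁` at rate `λ`:
`w(s) = α₁ + λ(C(s) - C(t₁))`. [derived: this file] -/
def swingAngle (α₁ lam : ℝ) (C : ℝ → ℝ) (t₁ s : ℝ) : ℝ := α₁ + lam * (C s - C t₁)

/-- §278(d) its derivative along the flow is `λc`. [derived: this file] -/
theorem hasDerivAt_swingAngle (hC : ∀ t, HasDerivAt C (X t 2) t) (α₁ lam t₁ s : ℝ) :
    HasDerivAt (swingAngle α₁ lam C t₁) (lam * X s 2) s := by
  show HasDerivAt (fun s => α₁ + lam * (C s - C t₁)) (lam * X s 2) s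
  exact (((hC s).sub_const (C t₁)).const_mul lam).const_add α₁

/-! ## §279 The entry half band -/

/-- §279(a) THE WINDOW OF THE CLOCK ANGLE (any member from `delayInit`, `ε, M > 0`; on the band
`[t₁, t₂]`: ring from below `R₂² + ε²/M ≤ Q ≤ b² + c²`, `b² < R₂²`, aspect defect
`κc ≤ √(R₂² - b²)`, and SYMMETRIC EDGES `b(t₂) = -b(t₁)`). For `s ∈ [t₁, t₂]`, with
`λ = ε⁻¹Mκ`, `α = arccos(b/R₂)`, `α₁ = α(t₁)`: `α₁ + λ(C(s) - C(t₁)) ≤ α(s)`,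
`α(s) ≤ π - α₁ - λ(C(t₂) - C(s))` and `0 < α₁` (part 99 §274 run forward from `t₁` and on
`[s, t₂]`, with `arccos(-x) = π - arccos x`). [derived: part 99 §274] -/
theorem swing_window (hX : ∀ t, HasDerivAt X (RotorKnob.rotorCircuit K M ε ρ (X t)) t)
    (h0 : X 0 = delayInit) (hC : ∀ t, HasDerivAt C (X t 2) t) (hε : 0 < ε) (hM : 0 < M)
    {t₁ t₂ R₂ Q κ : ℝ} (ht : t₁ ≤ t₂) (hR : 0 < R₂) (hQ : R₂ ^ 2 + ε ^ 2 / M ≤ Q)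
    (hring : ∀ u ∈ Icc t₁ t₂, Q ≤ X u 1 ^ 2 + X u 2 ^ 2)
    (hband : ∀ u ∈ Icc t₁ t₂, X u 1 ^ 2 < R₂ ^ 2)
    (hκ : ∀ u ∈ Icc t₁ t₂, κ * X u 2 ≤ √(R₂ ^ 2 - X u 1 ^ 2)) (hsym : X t₂ 1 = -X t₁ 1)
    {s : ℝ} (hs : s ∈ Icc t₁ t₂) :
    arccos (X t₁ 1 / R₂) + ε⁻¹ * M * κ * (C s - C t₁) ≤ arccos (X s 1 / R₂) ∧
      arccos (X s 1 / R₂) ≤ π - arccos (X t₁ 1 / R₂) - ε⁻¹ * M * κ * (C t₂ - C s) ∧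
      0 < arccos (X t₁ 1 / R₂) := by
  have h1 := clock_angle_lower hX h0 hC hε hM hs.1 hR hQ
    (fun u hu => hring u ⟨hu.1, hu.2.trans hs.2⟩) (fun u hu => hband u ⟨hu.1, hu.2.trans hs.2⟩)
    (fun u hu => hκ u ⟨hu.1, hu.2.trans hs.2⟩)
  have h2 := clock_angle_lower hX h0 hC hε hM hs.2 hR hQ
    (fun u hu => hring u ⟨hs.1.trans hu.1, hu.2⟩) (fun u hu => hband u ⟨hs.1.trans hu.1, hu.2⟩)
    (fun u hu => hκ u ⟨hs.1.trans hu.1, hu.2⟩)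
  have hneg : arccos (X t₂ 1 / R₂) = π - arccos (X t₁ 1 / R₂) := by
    rw [hsym, neg_div, arccos_neg]
  rw [hneg] at h2
  have hb := hband t₁ (left_mem_Icc.2 ht)
  have hlt : X t₁ 1 / R₂ < 1 := by
    rw [div_lt_one hR]
    exact (abs_lt_of_sq_lt_sq' hb hR.le).2
  exact ⟨by linarith only [h1], by linarith only [h2], arccos_pos.2 hlt⟩

/-- §279(b) THE ENTRY HALF-BAND LAW (any member from `delayInit`, `K ≥ 0`, `ε, M > 0`, UNIT
LATTICE `ε⁻¹Mρ² = 1`; on the band `[t₁, t₂]`: the hypotheses of `swing_window`, `c ≥ 0`, and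
a PHASE-LOCKED transfer mode `d² ≤ A(sin²((C - C(r))/ρ² + φ₀) + E)`, `A, E ≥ 0`,
`0 < κ ≤ 1`; abbreviations `λ = ε⁻¹Mκ`, `α₁ = arccos(b(t₁)/R₂)`,
`ψ₁ = (C(t₁) - C(r))/ρ² + φ₀ - α₁`, `E₁ = E + π(κ⁻¹ - 1)`). For `t ∈ [t₁, t₂]` in the ENTRY
HALF `2C(t) ≤ C(t₁) + C(t₂)`: `0 < α₁`, `C(t₁) ≤ C(t)`, `α₁ + λ(C(t) - C(t₁)) ≤ π/2`, and
`ã(t) - ã(t₁) ≤ (KA/(λR₂))·(swingPrim ψ₁ E₁ (α₁ + λ(C(t) - C(t₁))) - swingPrim ψ₁ E₁ α₁)`.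
[derived: part 99 §274–§275; this file §278, §279(a)] -/
theorem swing_transfer_first
    (hX : ∀ t, HasDerivAt X (RotorKnob.rotorCircuit K M ε ρ (X t)) t) (h0 : X 0 = delayInit)
    (hC : ∀ t, HasDerivAt C (X t 2) t) (hK : 0 ≤ K) (hε : 0 < ε) (hM : 0 < M)
    (hlat : ε⁻¹ * M * ρ ^ 2 = 1) {t₁ t₂ r R₂ Q κ A E φ₀ α₁ ψ₁ E₁ : ℝ} (ht : t₁ ≤ t₂)
    (hR : 0 < R₂) (hQ : R₂ ^ 2 + ε ^ 2 / M ≤ Q) (hκ0 : 0 < κ) (hκ1 : κ ≤ 1) (hA : 0 ≤ A)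
    (hE : 0 ≤ E) (hring : ∀ u ∈ Icc t₁ t₂, Q ≤ X u 1 ^ 2 + X u 2 ^ 2)
    (hband : ∀ u ∈ Icc t₁ t₂, X u 1 ^ 2 < R₂ ^ 2)
    (hκ : ∀ u ∈ Icc t₁ t₂, κ * X u 2 ≤ √(R₂ ^ 2 - X u 1 ^ 2))
    (hpos : ∀ u ∈ Icc t₁ t₂, 0 ≤ X u 2) (hsym : X t₂ 1 = -X t₁ 1)
    (hd : ∀ u ∈ Icc t₁ t₂, X u 3 ^ 2 ≤ A * (sin ((C u - C r) / ρ ^ 2 + φ₀) ^ 2 + E))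
    (hα₁ : α₁ = arccos (X t₁ 1 / R₂)) (hψ₁ : ψ₁ = (C t₁ - C r) / ρ ^ 2 + φ₀ - α₁)
    (hE₁ : E₁ = E + π * (κ⁻¹ - 1)) {t : ℝ} (ht₁ : t ∈ Icc t₁ t₂)
    (hhalf : 2 * C t ≤ C t₁ + C t₂) :
    0 < α₁ ∧ C t₁ ≤ C t ∧ α₁ + ε⁻¹ * M * κ * (C t - C t₁) ≤ π / 2 ∧
      X t 4 - X t₁ 4 ≤ K * A / (ε⁻¹ * M * κ * R₂) *
        (swingPrim ψ₁ E₁ (α₁ + ε⁻¹ * M * κ * (C t - C t₁)) - swingPrim ψ₁ E₁ α₁) := by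
  obtain ⟨lam, hlam⟩ : ∃ lam : ℝ, lam = ε⁻¹ * M * κ := ⟨_, rfl⟩
  rw [← hlam]
  have hμ0 : 0 < ε⁻¹ * M := by positivity
  have hlam0 : 0 < lam := by rw [hlam]; positivity
  have hρ2 : (ρ ^ 2)⁻¹ = ε⁻¹ * M := inv_eq_of_mul_eq_one_left hlat
  have hκinv : 0 ≤ κ⁻¹ - 1 := sub_nonneg.2 ((one_le_inv₀ hκ0).2 hκ1)
  have hE₁0 : 0 ≤ E₁ := by rw [hE₁]; positivity
  have hkk : κ⁻¹ * κ = 1 := inv_mul_cancel₀ hκ0.ne'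
  -- `C` is non-decreasing on the band
  have hCm := Thm53.monotoneOn_sub_of_le_deriv (f := C) (f' := fun u => X u 2)
    (Φ := fun _ => (0 : ℝ)) (φ := fun _ => 0) (convex_Icc t₁ t₂) (fun u _ => hC u)
    (fun u _ => hasDerivAt_const u 0) (fun u hu => hpos u hu)
  have hα0 : 0 < α₁ := by
    rw [hα₁]; exact (swing_window hX h0 hC hε hM ht hR hQ hring hband hκ hsym ht₁).2.2
  -- the pointwise facts on `[t₁, t]`
  have KEY : ∀ s ∈ Icc t₁ t, 0 < swingAngle α₁ lam C t₁ s ∧ swingAngle α₁ lam C t₁ s ≤ π / 2 ∧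
      C t₁ ≤ C s ∧ K * X s 3 ^ 2 ≤ K * A / (lam * R₂) *
        ((sin (swingAngle α₁ lam C t₁ s + ψ₁) ^ 2 + E₁) / sin (swingAngle α₁ lam C t₁ s)
          * (lam * X s 2)) := by
    intro s hs
    have hs2 : s ∈ Icc t₁ t₂ := ⟨hs.1, hs.2.trans ht₁.2⟩
    obtain ⟨h1, h2, -⟩ := swing_window hX h0 hC hε hM ht hR hQ hring hband hκ hsym hs2
    rw [← hlam, ← hα₁] at h1 h2
    have hc1 := hCm (left_mem_Icc.2 ht) hs2 hs.1
    have hc3 := hCm hs2 ht₁ hs.2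
    dsimp only at hc1 hc3
    have hc1' : C t₁ ≤ C s := by linarith only [hc1]
    have hfirst : lam * (C s - C t₁) ≤ lam * (C t₂ - C s) :=
      mul_le_mul_of_nonneg_left (by linarith only [hc3, hhalf]) hlam0.le
    unfold swingAngle
    obtain ⟨w, hw⟩ : ∃ w : ℝ, w = α₁ + lam * (C s - C t₁) := ⟨_, rfl⟩
    rw [← hw] at h1 ⊢
    have hwle : arccos (X s 1 / R₂) ≤ π - w := by rw [hw]; linarith only [h2, hfirst]
    have hw0 : 0 < w := by
      rw [hw]
      have := mul_nonneg hlam0.le (sub_nonneg.2 hc1')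
      linarith only [this, hα0]
    have hwπ : w ≤ π / 2 := by linarith only [h1, hwle]
    have hsw : 0 < sin w := sin_pos_of_pos_of_lt_pi hw0 (by linarith only [hwπ, pi_pos])
    have hsin : sin w ≤ sin (arccos (X s 1 / R₂)) := sin_le_sin_of_window hw0.le h1 hwle
    have hring2 : R₂ ^ 2 ≤ X s 1 ^ 2 + X s 2 ^ 2 := by
      have h3 := hring s hs2
      have h4 : 0 ≤ ε ^ 2 / M := by positivity
      linarith only [h3, h4, hQ]
    have hcs : R₂ * sin w ≤ X s 2 :=
      (mul_le_mul_of_nonneg_left hsin hR.le).trans (trigger_ge_sin_angle hR hring2 (hpos s hs2))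
    -- the phase of the transfer mode is `w + ψ₁` up to the lag `(ε⁻¹M - λ)(C s - C t₁)`
    have hl1 : (C s - C r) / ρ ^ 2 + φ₀ = (w + ψ₁) + (ε⁻¹ * M - lam) * (C s - C t₁) := by
      rw [hw, hψ₁, div_eq_mul_inv, div_eq_mul_inv, hρ2]
      ring
    have hl2 : (κ⁻¹ - 1) * (lam * (C s - C t₁)) = (ε⁻¹ * M - lam) * (C s - C t₁) := by
      rw [hlam]
      calc (κ⁻¹ - 1) * (ε⁻¹ * M * κ * (C s - C t₁))
            = (κ⁻¹ * κ) * (ε⁻¹ * M * (C s - C t₁)) - ε⁻¹ * M * κ * (C s - C t₁) := by ring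
        _ = (ε⁻¹ * M - ε⁻¹ * M * κ) * (C s - C t₁) := by rw [hkk]; ring
    have hlb : 2 * |(ε⁻¹ * M - lam) * (C s - C t₁)| ≤ π * (κ⁻¹ - 1) := by
      have hn : 0 ≤ (κ⁻¹ - 1) * (lam * (C s - C t₁)) :=
        mul_nonneg hκinv (mul_nonneg hlam0.le (sub_nonneg.2 hc1'))
      rw [← hl2, abs_of_nonneg hn]
      have hle : lam * (C s - C t₁) ≤ π / 2 := by linarith only [hwπ, hw, hα0]
      have := mul_le_mul_of_nonneg_left hle hκinv
      linarith only [this]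
    have hds : X s 3 ^ 2 ≤ A * (sin (w + ψ₁) ^ 2 + E₁) := by
      have h := hd s hs2
      rw [hl1] at h
      have hsh := mul_le_mul_of_nonneg_left
        (sin_sq_shift_le (w + ψ₁) ((ε⁻¹ * M - lam) * (C s - C t₁))) hA
      have hlb' := mul_le_mul_of_nonneg_left hlb hA
      rw [hE₁]
      linarith only [h, hsh, hlb']
    exact ⟨hw0, hwπ, hc1', swing_step_le hK hA hlam0 hR hsw hE₁0 hds hcs⟩
  -- the comparison `ã - (KA/(λR₂))·swingPrim ψ₁ E₁ (w)` is non-increasing on `[t₁, t]`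
  have hanti := Thm53.antitoneOn_sub_of_deriv_le (f := fun s => X s 4)
    (f' := fun s => K * X s 3 ^ 2)
    (Φ := fun s => K * A / (lam * R₂) * swingPrim ψ₁ E₁ (swingAngle α₁ lam C t₁ s))
    (φ := fun s => K * A / (lam * R₂) *
      ((sin (swingAngle α₁ lam C t₁ s + ψ₁) ^ 2 + E₁) / sin (swingAngle α₁ lam C t₁ s)
        * (lam * X s 2)))
    (convex_Icc t₁ t) (fun s _ => RotorKnob.hasDerivAt_e hX s)
    (fun s hs => ((hasDerivAt_swingPrim ψ₁ E₁ (KEY s hs).1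
      (by linarith only [(KEY s hs).2.1, pi_pos])).comp s
        (hasDerivAt_swingAngle hC α₁ lam t₁ s)).const_mul (K * A / (lam * R₂)))
    (fun s hs => (KEY s hs).2.2.2)
  have h := hanti (left_mem_Icc.2 ht₁.1) (right_mem_Icc.2 ht₁.1) ht₁.1
  have hK1 := KEY t (right_mem_Icc.2 ht₁.1)
  simp only [swingAngle, sub_self, mul_zero, add_zero] at h hK1
  exact ⟨hα0, hK1.2.2.1, hK1.2.1, by linarith only [h]⟩

/-- §279(c) THE ENTRY HALF-BAND LAW, PRICED (same hypotheses): with part 99 §275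
`swingPrim_eval_le` (`0 < α₁ ≤ w(t) ≤ π/2`, `E₁ ≥ 0`),
`ã(t) - ã(t₁) ≤ (KA/(λR₂))·(cos²ψ₁·cos α₁ + |sin 2ψ₁|·(1 - sin α₁)
- (sin²ψ₁ + E₁)·(log sin(α₁/2) - log cos(α₁/2)))` — at `cos α₁ = 31/32`:
`(0.969cos²ψ₁ + 0.752|sin 2ψ₁| + 2.072(sin²ψ₁ + E₁))·KA/(λR₂)`.
[derived: this file §279(b); part 99 §275] -/
theorem swing_transfer_first_le
    (hX : ∀ t, HasDerivAt X (RotorKnob.rotorCircuit K M ε ρ (X t)) t) (h0 : X 0 = delayInit)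
    (hC : ∀ t, HasDerivAt C (X t 2) t) (hK : 0 ≤ K) (hε : 0 < ε) (hM : 0 < M)
    (hlat : ε⁻¹ * M * ρ ^ 2 = 1) {t₁ t₂ r R₂ Q κ A E φ₀ α₁ ψ₁ E₁ : ℝ} (ht : t₁ ≤ t₂)
    (hR : 0 < R₂) (hQ : R₂ ^ 2 + ε ^ 2 / M ≤ Q) (hκ0 : 0 < κ) (hκ1 : κ ≤ 1) (hA : 0 ≤ A)
    (hE : 0 ≤ E) (hring : ∀ u ∈ Icc t₁ t₂, Q ≤ X u 1 ^ 2 + X u 2 ^ 2)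
    (hband : ∀ u ∈ Icc t₁ t₂, X u 1 ^ 2 < R₂ ^ 2)
    (hκ : ∀ u ∈ Icc t₁ t₂, κ * X u 2 ≤ √(R₂ ^ 2 - X u 1 ^ 2))
    (hpos : ∀ u ∈ Icc t₁ t₂, 0 ≤ X u 2) (hsym : X t₂ 1 = -X t₁ 1)
    (hd : ∀ u ∈ Icc t₁ t₂, X u 3 ^ 2 ≤ A * (sin ((C u - C r) / ρ ^ 2 + φ₀) ^ 2 + E))
    (hα₁ : α₁ = arccos (X t₁ 1 / R₂)) (hψ₁ : ψ₁ = (C t₁ - C r) / ρ ^ 2 + φ₀ - α₁)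
    (hE₁ : E₁ = E + π * (κ⁻¹ - 1)) {t : ℝ} (ht₁ : t ∈ Icc t₁ t₂)
    (hhalf : 2 * C t ≤ C t₁ + C t₂) :
    X t 4 - X t₁ 4 ≤ K * A / (ε⁻¹ * M * κ * R₂) *
      (cos ψ₁ ^ 2 * cos α₁ + |sin (2 * ψ₁)| * (1 - sin α₁)
        - (sin ψ₁ ^ 2 + E₁) * (log (sin (α₁ / 2)) - log (cos (α₁ / 2)))) := by
  obtain ⟨hα0, hc1, hwπ, h⟩ := swing_transfer_first hX h0 hC hK hε hM hlat ht hR hQ hκ0 hκ1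
    hA hE hring hband hκ hpos hsym hd hα₁ hψ₁ hE₁ ht₁ hhalf
  have hE₁0 : 0 ≤ E₁ := by
    rw [hE₁]
    have : 0 ≤ κ⁻¹ - 1 := sub_nonneg.2 ((one_le_inv₀ hκ0).2 hκ1)
    positivity
  have hlam0 : 0 < ε⁻¹ * M * κ := by positivity
  have hαw : α₁ ≤ α₁ + ε⁻¹ * M * κ * (C t - C t₁) := by
    have := mul_nonneg hlam0.le (sub_nonneg.2 hc1)
    linarith only [this]
  have hev := swingPrim_eval_le ψ₁ hE₁0 hα0 hαw hwπ
  have hcoef : 0 ≤ K * A / (ε⁻¹ * M * κ * R₂) := by positivity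
  exact h.trans (mul_le_mul_of_nonneg_left hev hcoef)

end Summit.NavierStokesRegularity.FluidComputer.GateBudget
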